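import Summits.ResolutionOfSingularities.ResolutionOfSingularities.Theorems.FrobeniusClosingPatchingRelPerfectDepthLegalTrace
import Literature.AlgebraicGeometry.Resolution.RegularCentreComponents
import Literature.AlgebraicGeometry.Resolution.KollarNmPartBlowup
import Literature.AlgebraicGeometry.Resolution.EtaleVanishingIdeal
import Literature.AlgebraicGeometry.Resolution.CoefficientIdealRestriction
import Literature.AlgebraicGeometry.Resolution.BlowupDisjointCentreWeights
import Mathlib.CategoryTheory.ConcreteCategory.EpiMono
import HarnessLib

/-!
# Crux `PatchingRelPerfect` (stmt-ResolutionOfSingularities-16161), chain W5.2 — T6-E1b residual `LegalScopedDivisorReduction₃`,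
# PHASE 2 closer (2b), D7 step 2: ONE HOST COMPONENT AT A TIME — the inclusion of a component is an open immersion

[OURS · L1 W5.2 · res-D-pv-052 g6 for the (2b) D7 closer, BY NAME from res-L1-w52-lead-1's `ORACLE-HANDOFF.md` (873ae9ed5877222f) §O4
(«split the host into integral components») and `PHASE2-STEPB-SPEC.md` D1] Replaces the role of NO printed item; NOT a statement of the
manuscript under review; fact-free.

The curve-move loop of STEP B (`DepthLegal.curve_loop`) runs on an INTEGRAL host, while STEP A (`DepthLegal.HostState.stepA`) and the
oracle's entry invariant (`…DepthLegalOracleEntry`) are global over the regular host `V(D)`, the disjoint union of its irreducible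
components `Z ∈ boundaryPieces D` (Stacks 0357).  To run the loop component by component one needs the invariant ON THE COMPONENT
`V(𝓘(Z))` as a scheme of its own:

* `isOpenImmersion_inclusion_piece` — for a regular centre `V(C)` with piece partition `Zs` and `Z ∈ Zs`, the inclusion
  `V(𝓘(Z)) ⟶ V(C)` of closed subschemes (`Scheme.IdealSheafData.inclusion`, `C ≤ 𝓘(Z)`) is an OPEN IMMERSION: a topological embedding
  with open range `ι⁻¹ Z` (the pieces are clopen in `V(C)`, `IsPiecePartition.exists_nhd`) and bijective stalk maps (both stalks are
  `𝒪_{X,x} ⧸ C_x`, `stalkIdeal_centrePiece_eq`);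
* `exists_sncd_trace_piece` — hence a strict normal crossings divisor of `V(C)` containing the trace `M|_{V(C)}` pulls back
  (`IsStrictNormalCrossingsDivisor.preimage_of_etale`) to one of `V(𝓘(Z))` containing `M|_{V(𝓘(Z))}`;
* `le_vanishingIdeal_piece`, `comap_subschemeι_piece` — bookkeeping (`C ≤ 𝓘(Z)`; `M|_{V(𝓘 Z)} = (M|_{V(C)})|`).

AI-written; AI review is weaker than expert review.

## References
* The Stacks Project, Tags 0357, 01J7, 02OS. [StacksProject]
* E. Bierstone, D. Grigoriev, P. Milman, J. Włodarczyk, arXiv:1206.3090, §4 Step 2 (p. 12). [BierstoneGrigorievMilmanWlodarczyk2011]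
-/

-- `Summit.<Summit>.<Sub>.Theorems` with `Sub = Summit` (single-conjunct summit, D-0017)
set_option linter.dupNamespace false

noncomputable section

open CategoryTheory CategoryTheory.Limits AlgebraicGeometry TopologicalSpace IsLocalRing Topology
open Literature.AlgebraicGeometry.Resolution Scheme.IdealSheafData

namespace Summit.ResolutionOfSingularities.ResolutionOfSingularities.Theorems

universe u

namespace DepthLegal

variable {X : Scheme.{u}}

/-- `C ≤ 𝓘(Z)` for a piece `Z` of a regular centre `V(C)` (`C = Π 𝓘(pieces)`). [cite: StacksProject, Tag 0357] -/
theorem le_vanishingIdeal_piece [IsLocallyNoetherian X] {C : X.IdealSheafData} (hC : Scheme.IsRegular C.subscheme)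
    {Zs : List (Closeds X)} (hZs : IsPiecePartition C Zs) {Z : Closeds X} (hZ : Z ∈ Zs) : C ≤ vanishingIdeal Z := by
  rw [← prod_pieceIdeals_eq_of_isRegular hC hZs]
  exact prod_pieceIdeals_le_of_mem hZ

/-- [OURS · L1 W5.2] **The inclusion of a component of a regular centre is an open immersion** (module docstring).
[cite: StacksProject, Tag 0357] [cite: StacksProject, Tag 01J7] -/
theorem isOpenImmersion_inclusion_piece [IsLocallyNoetherian X] {C : X.IdealSheafData} (hC : Scheme.IsRegular C.subscheme)
    {Zs : List (Closeds X)} (hZs : IsPiecePartition C Zs) {Z : Closeds X} (hZ : Z ∈ Zs) (hle : C ≤ vanishingIdeal Z) :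
    IsOpenImmersion (Scheme.IdealSheafData.inclusion hle) := by
  set P : X.IdealSheafData := vanishingIdeal Z with hPdef
  set f := Scheme.IdealSheafData.inclusion hle with hfdef
  have hf : f ≫ C.subschemeι = P.subschemeι := Scheme.IdealSheafData.inclusion_subschemeι hle
  have hfx : ∀ x : P.subscheme, C.subschemeι (f x) = P.subschemeι x := fun x => by
    rw [← Scheme.Hom.comp_apply, hf]
  -- points of the piece
  have hmemZ : ∀ x : P.subscheme, C.subschemeι (f x) ∈ (Z : Set X) := fun x => by
    rw [hfx, ← Scheme.IdealSheafData.coe_support_vanishingIdeal Z]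
    exact subschemeι_apply_mem_support P x
  -- (i) the underlying map is an open embedding
  have hemb : IsEmbedding f.base := by
    refine IsEmbedding.of_comp f.base.hom.continuous C.subschemeι.base.hom.continuous ?_
    have hcomp : (C.subschemeι.base : C.subscheme → X) ∘ f.base = P.subschemeι.base := by
      funext x; exact hfx x
    rw [hcomp]
    exact P.subschemeι.isClosedEmbedding.isEmbedding
  have hrange : Set.range f.base = C.subschemeι.base ⁻¹' (Z : Set X) := by
    ext y
    constructor
    · rintro ⟨x, rfl⟩; exact hmemZ x
    · intro hy
      have hy' : C.subschemeι y ∈ Set.range P.subschemeι.base := by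
        rw [Scheme.IdealSheafData.range_subschemeι, Scheme.IdealSheafData.coe_support_vanishingIdeal]; exact hy
      obtain ⟨x, hx⟩ := hy'
      refine ⟨x, C.subschemeι.isClosedEmbedding.injective ?_⟩
      rw [hfx x]; exact hx
  have hopen : IsOpen (Set.range f.base) := by
    rw [hrange, isOpen_iff_forall_mem_open]
    intro y hy
    obtain ⟨U, hyU, hU⟩ := hZs.exists_nhd hZ hy
    refine ⟨C.subschemeι.base ⁻¹' (U : Set X), fun y' hy' => ?_, U.2.preimage C.subschemeι.base.hom.continuous, hyU⟩
    have h1 : C.subschemeι y' ∈ (C.support : Set X) ∩ U := ⟨subschemeι_apply_mem_support C y', hy'⟩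
    rw [← hU] at h1
    exact h1.1
  have hoe : IsOpenEmbedding f.base := ⟨hemb, hopen⟩
  -- (ii) the stalk maps are bijective
  haveI : ∀ x : P.subscheme, IsIso (f.stalkMap x) := by
    intro x
    -- the two surjections from `𝒪_{X, ι x}` and their (equal) kernels
    have hsurjC : Function.Surjective (C.subschemeι.stalkMap (f x)).hom := C.subschemeι.stalkMap_surjective _
    have hkerC : RingHom.ker (C.subschemeι.stalkMap (f x)).hom = stalkIdeal C (C.subschemeι (f x)) :=
      ker_stalkMap_subschemeι C (f x)
    have hsurjP : Function.Surjective ((f ≫ C.subschemeι).stalkMap x).hom := by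
      rw [hf]; exact P.subschemeι.stalkMap_surjective x
    have hkerP : RingHom.ker ((f ≫ C.subschemeι).stalkMap x).hom = stalkIdeal P ((f ≫ C.subschemeι) x) := by
      rw [hf]; exact ker_stalkMap_subschemeι P x
    have hcomp : ((f ≫ C.subschemeι).stalkMap x).hom = (f.stalkMap x).hom.comp (C.subschemeι.stalkMap (f x)).hom := by
      rw [Scheme.Hom.stalkMap_comp]; rfl
    -- `𝓘(Z)_y = C_y` at the points of the piece
    have hPC : stalkIdeal P ((f ≫ C.subschemeι) x) = stalkIdeal C (C.subschemeι (f x)) :=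
      stalkIdeal_centrePiece_eq hC hZs hZ (hmemZ x)
    have hkk : RingHom.ker ((f ≫ C.subschemeι).stalkMap x).hom = RingHom.ker (C.subschemeι.stalkMap (f x)).hom :=
      hkerP.trans (hPC.trans hkerC.symm)
    refine (ConcreteCategory.isIso_iff_bijective _).mpr ⟨?_, ?_⟩
    · rw [injective_iff_map_eq_zero]
      intro a ha
      obtain ⟨r, rfl⟩ := hsurjC a
      have h1 : ((f ≫ C.subschemeι).stalkMap x).hom r = 0 := by
        rw [hcomp]; exact ha
      have h2 := (SetLike.ext_iff.mp hkk r).mp (RingHom.mem_ker.mpr h1)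
      exact RingHom.mem_ker.mp h2
    · intro b
      obtain ⟨r, hr⟩ := hsurjP b
      refine ⟨(C.subschemeι.stalkMap (f x)).hom r, ?_⟩
      have h1 : ((f ≫ C.subschemeι).stalkMap x).hom r = (f.stalkMap x).hom ((C.subschemeι.stalkMap (f x)).hom r) := by
        rw [hcomp]; rfl
      exact h1 ▸ hr
  exact IsOpenImmersion.of_isIso_stalkMap f hoe

/-- **The trace on a piece is the restriction of the trace on the host**: `M|_{V(𝓘 Z)} = (M|_{V(C)})𝒪` along the inclusion. [folklore] -/
theorem comap_subschemeι_piece {C P : X.IdealSheafData} (hle : C ≤ P) (M : X.IdealSheafData) :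
    M.comap P.subschemeι = (M.comap C.subschemeι).comap (Scheme.IdealSheafData.inclusion hle) := by
  rw [← Scheme.IdealSheafData.comap_comp, Scheme.IdealSheafData.inclusion_subschemeι]

/-- [OURS · L1 W5.2] **`Inv₃` passes to each component of the host**: a strict normal crossings divisor of `V(C)` containing the trace
`Supp (M|_{V(C)})` pulls back along the open immersion `V(𝓘(Z)) ⟶ V(C)` to one of the component containing `Supp (M|_{V(𝓘 Z)})`.
[cite: StacksProject, Tag 0357] [cite: DeJong1996, 2.4] -/
theorem exists_sncd_trace_piece [IsLocallyNoetherian X] {C : X.IdealSheafData} (hC : Scheme.IsRegular C.subscheme)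
    {Zs : List (Closeds X)} (hZs : IsPiecePartition C Zs) {Z : Closeds X} (hZ : Z ∈ Zs) (M : X.IdealSheafData)
    (h : ∃ BX : Set C.subscheme, IsStrictNormalCrossingsDivisor C.subscheme BX ∧
      (((M.comap C.subschemeι).support : Set C.subscheme)) ⊆ BX) :
    ∃ BX : Set (vanishingIdeal Z).subscheme, IsStrictNormalCrossingsDivisor (vanishingIdeal Z).subscheme BX ∧
      (((M.comap (vanishingIdeal Z).subschemeι).support : Set (vanishingIdeal Z).subscheme)) ⊆ BX := by
  obtain ⟨BX, hBX, hT⟩ := h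
  have hle : C ≤ vanishingIdeal Z := le_vanishingIdeal_piece hC hZs hZ
  haveI := isOpenImmersion_inclusion_piece hC hZs hZ hle
  haveI : IsLocallyNoetherian C.subscheme := LocallyOfFiniteType.isLocallyNoetherian C.subschemeι
  refine ⟨(Scheme.IdealSheafData.inclusion hle).base ⁻¹' BX, hBX.preimage_of_etale (Scheme.IdealSheafData.inclusion hle),
    fun x hx => ?_⟩
  rw [comap_subschemeι_piece hle M] at hx
  exact hT ((mem_support_comap_iff _ _ x).mp hx)

end DepthLegal

end Summit.ResolutionOfSingularities.ResolutionOfSingularities.Theorems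

end
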